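import Summits.ABC.ABC.Theorems.TowerFourSubLiouville.Negative.TwoExponentSandwich
import Summits.ABC.ABC.Theorems.TowerFourSubLiouville.Negative.TorusBezoutCorner

/-!
# `TowerFourSubLiouville` (stmt-ABC-1649): `ABC` gives the WHOLE random-model half-plane `θ + φ < 2` of the
two-exponent diagram — the `ABC` line of the uniform core IS the torus Mason–Stothers plane

Negative-side module of the standing disprover (cycle 13, refuter-cdisprove-stmt-ABC-1649-g13-0, 2026-08-17), sharpening
`Negative.TwoExponentSandwich` (p137739, cycle 11) and closing the calibration of the crux-equivalent core against `ABC`.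

The open core of the crux is the diagonal `θ = φ = η` of the two-exponent uniform binomial quartic saving
`UBQ₂(θ, φ)`: `∃ Z₀ ∀ v w Y Z ≥ Z₀` (positive, `gcd(vY, wZ) = 1`, `wZ⁴ ≠ vY⁴`): `max(v,w) ≤ Z^θ ⟹ |wZ⁴ − vY⁴| > Z^φ`
(crux ⟺ `∃ η > 0, UBQ₂(η, η)`, p87895 + p86153).  Cycle 11 proved `ABC ⟹ UBQ₂` on `(9/4)θ + φ < 2`.  Two savings were
left on the table there: (i) the larger summand is `c ≥ w·Z⁴`, not just `Z⁴` — keeping `w` in `c` cancels one full power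
of `w` from the radical; (ii) `Y ≍ (w/v)^{1/4} Z`, so `v·Y ≤ (2 v³ w)^{1/4} Z`: three quarters of `v` are absorbed by `Y`.
With both, an enemy `a = |wZ⁴ − vY⁴| ≤ Z^φ`, `v ≤ Z^{θ_v}`, `w ≤ Z^{θ_w}` turns the abc inequality `c < K·rad^{1+δ}`,
`rad ≤ a·v·w·Y·Z`, into `Z^{2 − O(δ)} ≲ a · v^{3/4} · w^{1/4}`, i.e. (`abc_enemy_numerics_sharp`, `δ = s/48`)

  **`ubq₃_of_abc`:  `ABC ⟹` the saving `|wZ⁴ − vY⁴| > Z^φ` beyond some `Z₀`, for all `θ_v, θ_w, φ ≥ 0` with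
  `(3/4)θ_v + (1/4)θ_w + φ < 2`**  (three-exponent matrix: `v ≤ Z^{θ_v}`, `w ≤ Z^{θ_w}` separately),

and the plane `(3/4)θ_v + (1/4)θ_w + φ = 2` is LITERALLY the torus Mason–Stothers inequality
`3·deg P ≤ deg V + deg Q + deg A` of `Negative.TorusEnemyFloor.masonStothers_torus_ineq` (p109688) for Laurent-polynomial
identities `W P⁴ − V Q⁴ = X^j A` (read with `deg Q = deg P + (deg W − deg V)/4`): the integers under `ABC` and the
identities on `𝔾_m` unconditionally see the same plane, from opposite sides.  Consequences (all in this file):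

* `ubq₂_of_abc_sharp`: **`ABC ⟹ UBQ₂(θ, φ)` for all `θ ≥ 0`, `θ + φ < 2`** — the whole open half-plane below the
  random-model boundary `θ + φ = 2` (pairs `≤ Z^{2θ}`, residue `≍ v^{1/4}w^{3/4}Z³`: expected violators `≍ Z^{θ+φ−3}` per
  scale).  `ubq₂_halfPlane_le_two` / `ubq₃_halfSpace_le_two`: UNCONDITIONALLY no half-plane `θ + φ < c` (no half-space
  `(3/4)θ_v + (1/4)θ_w + φ < c`) with `c > 2` is true — the Pell–Bezout torus corner `(2, 0)` (value EXACTLY `1` at height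
  `≤ 28Z²`, `not_ubq₂_corner_two_zero`, p138228) and the Dirichlet limit corner `(0, 2)` both lie ON the line.  So the
  statement is best possible of its shape, and the `ABC` side of the diagram is FINAL.
* `ubq_of_abc_sharp`: **diagonal, `ABC ⟹ UBQ η` for every `0 ≤ η < 1`** (was `8/13`) — the random-model critical value;
  with the unconditional ceiling `3/2` (padeFamily₂, p106450) the uniform dial of the core is bracketed `[1, 3/2]` under
  `ABC`, and ANY enemy family of the core at a diagonal value `< 1` refutes `ABC`.
* `ubq₂_axis_iff_of_abc`: **the axis `φ = 0` is PINNED at `θ* = 2` under `ABC`** (`UBQ₂(θ, 0) ↔ θ < 2` for `θ ≠ 2`; cycle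
  11: `8/9 ≤ θ* ≤ 2`): bounded values of coprime binomial quartic forms need quadratic coefficient height, and the torus
  family shows quadratic height suffices — the corner `(2,0)` is OPTIMAL short of `¬ABC`.  Column `θ_v = 0`
  (`ubq₃_of_abc_unit_v`): `Y⁴ ± a = wZ⁴` with `a ≤ Z^φ` needs `w > Z^{θ_w}` whenever `θ_w/4 + φ < 2` (value `1`: `w > Z^{8−o(1)}`).
* The strategist's ladder (`StrategistSketch.lean`: `UniformMovingRoth4 ⟹ UniformMovingThue4 ⟹ crux`) gets the
  RANDOM-MODEL budgets from `ABC`: `movingRoth4_of_abc_of_lt` (saving `Z^{2−ε}` at any budget `η < ε`; cycle 11: any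
  `η < 4ε/9`) and `movingThue4_of_abc_of_lt` / `movingThue4_of_abc_one` (saving `Z^{1−ε}` at any `η < 1 + ε`, in
  particular at the `ε`-INDEPENDENT budget `η = 1`; cycle 11: any `η < 4(1+ε)/9`).  Unconditional ceilings unchanged:
  Roth rung `η ≤ 1` (`ε < 1/2`), Thue rung `η ≤ 2` (p137739, p138228); under `ABC` the Thue-rung budget is in `[1 + ε, 2]`.

The `(θ, φ)` plane after this file (P = `ABC`-TRUE, this file; F = landed FALSE lobes; `?` = undetermined even under `ABC` —
the closed band between the line and the staircase, where the random model says FALSE and only rational identity shapes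
ON `θ + φ = 2` (torus; census open for asymmetric dessins, `Cruxes/…/Disproof.lean` § (11e)(x)) could add unconditional corners):
```
  φ
  2 ●(0,2)━━━━━━━━┳(1,2)━━━━━━━━━━━━━━━━   F: φ > 2 for every θ > 0 (Dirichlet, p125878)
    │P  ╲   ?     ┃ F
3/2 ┤P     ╲   ?  ●(1,3/2)━━━━━━┓ F            F: θ > 1, φ > 3/2 (padeFamily₂, p106450)
  1 ┤P            ╲    ?    ?   ┃ F
1/2 ┤P      θ+φ=2        ╲   ?  ┃ F                       F: θ > 2 for every φ ≥ 0 (Pell–Bezout torus, p138228)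
  0 ┼P──────────────────────────●(2,0)━━
    0             1             2       θ
```
For the crux nothing changes in truth value — `ABC ⟹ crux` (p74157), no kill short of `¬ABC` — but the calibration of
its core against `ABC` is now COMPLETE: every `ABC`-edge on this crux is tight against a landed unconditional witness
(`A = 1`: Pell; `UniformLjunggren K = 1` / `HallLang1728 κ = 2`: Pell-boosted transfer family; `TridentHallLang 5/4`;
`PolySzpiro 6`; and now the two-exponent diagram at `(2,0)` and `(0,2)`).
-/

-- `Summit.ABC.ABC` is the mandated summit-side namespace (CONVENTIONS §2); the duplicate is deliberate.
set_option linter.dupNamespace false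

namespace Summit.ABC.ABC.Theorems.TowerFourSubLiouville.Negative

open Literature.NumberTheory.DiophantineGeometry (IsABCTriple rad rad_def)

/-- Exponent bookkeeping for `abc_enemy_numerics_sharp`. -/
theorem sharp_exponent_le {δ s θv θw φ : ℝ} (hs : 0 < s) (hδ : δ = s / 48)
    (hsdef : s = 2 - 3 / 4 * θv - θw / 4 - φ) (hθv : 0 ≤ θv) (hφ : 0 ≤ φ) :
    4 * φ * (1 + δ) + 3 * θv * (1 + δ) + θw * (1 + 5 * δ) + (8 + 8 * δ) ≤ 16 - 3 * s := by
  have h1 : 3 * θv + θw + 4 * φ = 8 - 4 * s := by rw [hsdef]; ring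
  have h2 : 8 + 3 * θv + 5 * θw + 4 * φ ≤ 48 := by nlinarith
  have h3 : δ * (8 + 3 * θv + 5 * θw + 4 * φ) ≤ s := by
    rw [hδ]
    calc s / 48 * (8 + 3 * θv + 5 * θw + 4 * φ) ≤ s / 48 * 48 :=
          mul_le_mul_of_nonneg_left h2 (by positivity)
      _ = s := by ring
  have e : 4 * φ * (1 + δ) + 3 * θv * (1 + δ) + θw * (1 + 5 * δ) + (8 + 8 * δ) =
      (3 * θv + θw + 4 * φ + 8) + δ * (8 + 3 * θv + 5 * θw + 4 * φ) := by ring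
  rw [e]; linarith

/-- Real-exponent bookkeeping: the key numerical inequality behind `ubq₃_of_abc`.  From the `ABC` bound
`c < K · R^{1+δ}` with `w·Z⁴ ≤ c` (the coefficient `w` is KEPT), `R ≤ a·v·w·Y·Z`, `a ≤ Z^φ`, `v ≤ Z^{θ_v}`,
`w ≤ Z^{θ_w}`, `v·Y⁴ ≤ 2·w·Z⁴` (so `(vY)⁴ ≤ 2 v³ w Z⁴`: the coefficient `v` is three-quarters absorbed by `Y`) and
`δ = s/48`, `s = 2 − (3/4)θ_v − (1/4)θ_w − φ > 0`, one gets `Z^16 < K⁴ · 2^{1+δ} · Z^{16 − 3s}`. -/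
theorem abc_enemy_numerics_sharp {K δ s θv θw φ a v w Y Z R c : ℝ} (hK : 0 < K) (hs : 0 < s)
    (hδ : δ = s / 48) (hsdef : s = 2 - 3 / 4 * θv - θw / 4 - φ) (hθv : 0 ≤ θv) (hφ : 0 ≤ φ)
    (hZ : 1 ≤ Z) (ha : 0 ≤ a) (hv : 1 ≤ v) (hw : 1 ≤ w) (hR : 0 ≤ R)
    (hRle : R ≤ a * v * w * Y * Z) (hc : w * Z ^ (4:ℕ) ≤ c) (habc : c < K * R ^ (1 + δ))
    (haφ : a ≤ Z ^ φ) (hvθ : v ≤ Z ^ θv) (hwθ : w ≤ Z ^ θw) (hY4 : v * Y ^ (4:ℕ) ≤ 2 * w * Z ^ (4:ℕ)) :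
    Z ^ (16:ℝ) < K ^ (4:ℕ) * (2:ℝ) ^ (1 + δ) * Z ^ (16 - 3 * s) := by
  have hZ0 : 0 < Z := by linarith
  have hδ0 : 0 < δ := by rw [hδ]; linarith
  have hv0 : 0 < v := by linarith
  have hw0 : 0 < w := by linarith
  -- Step 1: R^4 ≤ 2 · (a^4 v^3 w^5 Z^8)
  set M : ℝ := a ^ (4:ℕ) * v ^ (3:ℕ) * w ^ (5:ℕ) * Z ^ (8:ℕ) with hM
  have hM0 : 0 ≤ M := by positivity
  have hR4 : R ^ (4:ℕ) ≤ 2 * M := by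
    have h1 : R ^ (4:ℕ) ≤ (a * v * w * Y * Z) ^ (4:ℕ) := pow_le_pow_left₀ hR hRle 4
    have h2 : (a * v * w * Y * Z) ^ (4:ℕ) =
        a ^ (4:ℕ) * v ^ (3:ℕ) * w ^ (4:ℕ) * Z ^ (4:ℕ) * (v * Y ^ (4:ℕ)) := by ring
    have h3 : a ^ (4:ℕ) * v ^ (3:ℕ) * w ^ (4:ℕ) * Z ^ (4:ℕ) * (v * Y ^ (4:ℕ)) ≤
        a ^ (4:ℕ) * v ^ (3:ℕ) * w ^ (4:ℕ) * Z ^ (4:ℕ) * (2 * w * Z ^ (4:ℕ)) :=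
      mul_le_mul_of_nonneg_left hY4 (by positivity)
    calc R ^ (4:ℕ) ≤ (a * v * w * Y * Z) ^ (4:ℕ) := h1
      _ = _ := h2
      _ ≤ _ := h3
      _ = 2 * M := by rw [hM]; ring
  -- Step 2: M^{1+δ} ≤ w^4 · Z^E
  set E : ℝ := 4 * φ * (1 + δ) + 3 * θv * (1 + δ) + θw * (1 + 5 * δ) + (8 + 8 * δ) with hE
  have hEle : E ≤ 16 - 3 * s := sharp_exponent_le hs hδ hsdef hθv hφ
  have ba : (a ^ (4:ℕ)) ^ (1 + δ) ≤ Z ^ (4 * φ * (1 + δ)) := by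
    have h1 : a ^ (4:ℕ) ≤ (Z ^ φ) ^ (4:ℕ) := pow_le_pow_left₀ ha haφ 4
    calc (a ^ (4:ℕ)) ^ (1 + δ) ≤ ((Z ^ φ) ^ (4:ℕ)) ^ (1 + δ) :=
          Real.rpow_le_rpow (by positivity) h1 (by linarith)
      _ = Z ^ (4 * φ * (1 + δ)) := by
          rw [← Real.rpow_natCast (Z ^ φ) 4, ← Real.rpow_mul (Real.rpow_nonneg hZ0.le _),
            ← Real.rpow_mul hZ0.le]
          norm_num; ring_nf
  have bv : (v ^ (3:ℕ)) ^ (1 + δ) ≤ Z ^ (3 * θv * (1 + δ)) := by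
    have h1 : v ^ (3:ℕ) ≤ (Z ^ θv) ^ (3:ℕ) := pow_le_pow_left₀ hv0.le hvθ 3
    calc (v ^ (3:ℕ)) ^ (1 + δ) ≤ ((Z ^ θv) ^ (3:ℕ)) ^ (1 + δ) :=
          Real.rpow_le_rpow (by positivity) h1 (by linarith)
      _ = Z ^ (3 * θv * (1 + δ)) := by
          rw [← Real.rpow_natCast (Z ^ θv) 3, ← Real.rpow_mul (Real.rpow_nonneg hZ0.le _),
            ← Real.rpow_mul hZ0.le]
          norm_num; ring_nf
  have bw : (w ^ (5:ℕ)) ^ (1 + δ) ≤ w ^ (4:ℕ) * Z ^ (θw * (1 + 5 * δ)) := by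
    have e1 : (w ^ (5:ℕ)) ^ (1 + δ) = w ^ (4:ℕ) * w ^ (1 + 5 * δ) := by
      rw [← Real.rpow_natCast w 5, ← Real.rpow_mul hw0.le, ← Real.rpow_natCast w 4,
        ← Real.rpow_add hw0]
      norm_num; ring_nf
    have h1 : w ^ (1 + 5 * δ) ≤ (Z ^ θw) ^ (1 + 5 * δ) :=
      Real.rpow_le_rpow hw0.le hwθ (by linarith)
    have e2 : (Z ^ θw) ^ (1 + 5 * δ) = Z ^ (θw * (1 + 5 * δ)) := by
      rw [← Real.rpow_mul hZ0.le]
    rw [e1]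
    exact mul_le_mul_of_nonneg_left (e2 ▸ h1) (by positivity)
  have bZ : (Z ^ (8:ℕ)) ^ (1 + δ) = Z ^ (8 + 8 * δ) := by
    rw [← Real.rpow_natCast Z 8, ← Real.rpow_mul hZ0.le]
    norm_num; ring_nf
  have stepM : M ^ (1 + δ) ≤ w ^ (4:ℕ) * Z ^ E := by
    have eM : M ^ (1 + δ) = (a ^ (4:ℕ)) ^ (1 + δ) * (v ^ (3:ℕ)) ^ (1 + δ) *
        (w ^ (5:ℕ)) ^ (1 + δ) * (Z ^ (8:ℕ)) ^ (1 + δ) := by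
      rw [hM, Real.mul_rpow (by positivity) (by positivity),
        Real.mul_rpow (by positivity) (by positivity), Real.mul_rpow (by positivity) (by positivity)]
    have eZ : Z ^ E = Z ^ (4 * φ * (1 + δ)) * Z ^ (3 * θv * (1 + δ)) * Z ^ (θw * (1 + 5 * δ)) *
        Z ^ (8 + 8 * δ) := by
      rw [hE, Real.rpow_add hZ0, Real.rpow_add hZ0, Real.rpow_add hZ0]
    rw [eM, eZ, bZ]
    have h0a : 0 ≤ (a ^ (4:ℕ)) ^ (1 + δ) := by positivity
    have h0v : 0 ≤ (v ^ (3:ℕ)) ^ (1 + δ) := by positivity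
    have h0w : 0 ≤ (w ^ (5:ℕ)) ^ (1 + δ) := by positivity
    calc (a ^ (4:ℕ)) ^ (1 + δ) * (v ^ (3:ℕ)) ^ (1 + δ) * (w ^ (5:ℕ)) ^ (1 + δ) * Z ^ (8 + 8 * δ)
        ≤ Z ^ (4 * φ * (1 + δ)) * Z ^ (3 * θv * (1 + δ)) * (w ^ (4:ℕ) * Z ^ (θw * (1 + 5 * δ))) *
            Z ^ (8 + 8 * δ) := by gcongr
      _ = w ^ (4:ℕ) * (Z ^ (4 * φ * (1 + δ)) * Z ^ (3 * θv * (1 + δ)) * Z ^ (θw * (1 + 5 * δ)) *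
            Z ^ (8 + 8 * δ)) := by ring
  -- Step 3: abc to the fourth power, and cancel w^4
  have hc0 : 0 < c := lt_of_lt_of_le (by positivity) hc
  have h4 : c ^ (4:ℕ) < (K * R ^ (1 + δ)) ^ (4:ℕ) := pow_lt_pow_left₀ habc hc0.le (by norm_num)
  have hlhs : w ^ (4:ℕ) * Z ^ (16:ℝ) ≤ c ^ (4:ℕ) := by
    have e : w ^ (4:ℕ) * Z ^ (16:ℝ) = (w * Z ^ (4:ℕ)) ^ (4:ℕ) := by
      rw [mul_pow, ← Real.rpow_natCast (Z ^ (4:ℕ)) 4, ← Real.rpow_natCast Z 4, ← Real.rpow_mul hZ0.le]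
      norm_num
    rw [e]; exact pow_le_pow_left₀ (by positivity) hc 4
  have step1 : (K * R ^ (1 + δ)) ^ (4:ℕ) = K ^ (4:ℕ) * (R ^ (4:ℕ)) ^ (1 + δ) := by
    rw [mul_pow]; congr 1
    rw [← Real.rpow_natCast (R ^ (1 + δ)), ← Real.rpow_mul hR, ← Real.rpow_natCast R, ← Real.rpow_mul hR]
    norm_num; ring_nf
  have step2 : (R ^ (4:ℕ)) ^ (1 + δ) ≤ (2 * M) ^ (1 + δ) := Real.rpow_le_rpow (by positivity) hR4 (by linarith)
  have step3 : (2 * M) ^ (1 + δ) = (2:ℝ) ^ (1 + δ) * M ^ (1 + δ) := Real.mul_rpow (by norm_num) hM0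
  have hZE : Z ^ E ≤ Z ^ (16 - 3 * s) := Real.rpow_le_rpow_of_exponent_le hZ hEle
  have main : w ^ (4:ℕ) * Z ^ (16:ℝ) < w ^ (4:ℕ) * (K ^ (4:ℕ) * (2:ℝ) ^ (1 + δ) * Z ^ (16 - 3 * s)) := by
    calc w ^ (4:ℕ) * Z ^ (16:ℝ) ≤ c ^ (4:ℕ) := hlhs
      _ < (K * R ^ (1 + δ)) ^ (4:ℕ) := h4
      _ = K ^ (4:ℕ) * (R ^ (4:ℕ)) ^ (1 + δ) := step1
      _ ≤ K ^ (4:ℕ) * ((2:ℝ) ^ (1 + δ) * M ^ (1 + δ)) := by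
          rw [← step3]; exact mul_le_mul_of_nonneg_left step2 (by positivity)
      _ ≤ K ^ (4:ℕ) * ((2:ℝ) ^ (1 + δ) * (w ^ (4:ℕ) * Z ^ (16 - 3 * s))) := by
          gcongr; exact le_trans stepM (mul_le_mul_of_nonneg_left hZE (by positivity))
      _ = w ^ (4:ℕ) * (K ^ (4:ℕ) * (2:ℝ) ^ (1 + δ) * Z ^ (16 - 3 * s)) := by ring
  exact lt_of_mul_lt_mul_left main (by positivity)

/-- **`ABC ⟹` the three-exponent uniform saving on the whole open half-space `(3/4)θ_v + (1/4)θ_w + φ < 2`.**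
For `θ_v, θ_w, φ ≥ 0` with `(3/4)θ_v + (1/4)θ_w + φ < 2`, `ABC` gives a threshold `Z₀` beyond which every coprime
`(vY, wZ)` with `v ≤ Z^{θ_v}`, `w ≤ Z^{θ_w}` has `|wZ⁴ − vY⁴| > Z^φ`.  The plane `(3/4)θ_v + (1/4)θ_w + φ = 2` is EXACTLY
the torus Mason–Stothers floor `3·deg P ≤ deg V + deg Q + deg A` of `Negative.TorusEnemyFloor.masonStothers_torus_ineq`
(p109688) read with `deg Q = deg P + (deg W − deg V)/4`: the integers see the same line as the Laurent polynomials. -/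
theorem ubq₃_of_abc (habc : ABC) {θv θw φ : ℝ} (hθv : 0 ≤ θv) (hθw : 0 ≤ θw) (hφ : 0 ≤ φ)
    (hplane : 3 / 4 * θv + θw / 4 + φ < 2) :
    ∃ Z₀ : ℕ, ∀ v w Y Z : ℕ, Z₀ ≤ Z → 0 < v → 0 < w → 0 < Y → Nat.Coprime (v * Y) (w * Z) →
      (v : ℝ) ≤ (Z : ℝ) ^ θv → (w : ℝ) ≤ (Z : ℝ) ^ θw → w * Z ^ 4 ≠ v * Y ^ 4 →
      (Z : ℝ) ^ φ < |((w * Z ^ 4 : ℕ) : ℝ) - ((v * Y ^ 4 : ℕ) : ℝ)| := by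
  set s : ℝ := 2 - 3 / 4 * θv - θw / 4 - φ with hsdef
  have hs : 0 < s := by rw [hsdef]; linarith
  set δ : ℝ := s / 48 with hδ
  have hδ0 : 0 < δ := by rw [hδ]; linarith
  obtain ⟨K, hK, hKabc⟩ := (ABC_iff.mp habc) δ hδ0
  obtain ⟨N, hN⟩ := eventually_const_mul_rpow_le (K ^ (4:ℕ) * (2:ℝ) ^ (1 + δ)) (16 - 3 * s) 16 (by linarith)
  refine ⟨max N 1, fun v w Y Z hZ hv hw hY hcop hvθ hwθ hne => ?_⟩
  have hZN : N ≤ Z := le_trans (le_max_left _ _) hZ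
  have hZR : (1:ℝ) ≤ (Z:ℝ) := by exact_mod_cast le_trans (le_max_right _ _) hZ
  have hvR : (1:ℝ) ≤ (v:ℝ) := by exact_mod_cast hv
  have hwR : (1:ℝ) ≤ (w:ℝ) := by exact_mod_cast hw
  have hφ2 : φ < 2 := by nlinarith
  by_contra hnot
  push Not at hnot
  have hcop4 : Nat.Coprime (v * Y ^ 4) (w * Z ^ 4) := coprime_binomial hcop
  have hφ4 : (Z:ℝ) ^ φ ≤ (w:ℝ) * (Z:ℝ) ^ (4:ℕ) := by -- a ≤ Z^φ ≤ Z^4 ≤ w Z^4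
    calc (Z:ℝ) ^ φ ≤ (Z:ℝ) ^ (4:ℝ) := Real.rpow_le_rpow_of_exponent_le hZR (by linarith)
      _ = 1 * (Z:ℝ) ^ (4:ℕ) := by rw [← Real.rpow_natCast, one_mul]; norm_num
      _ ≤ (w:ℝ) * (Z:ℝ) ^ (4:ℕ) := mul_le_mul_of_nonneg_right hwR (by positivity)
  rcases lt_or_gt_of_ne hne with hlt | hgt
  · -- case wZ⁴ < vY⁴ : triple (wZ⁴) + a = vY⁴, c = vY⁴ ≥ wZ⁴
    set a : ℕ := v * Y ^ 4 - w * Z ^ 4 with ha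
    have ha0 : 0 < a := Nat.sub_pos_of_lt hlt
    have hsum : w * Z ^ 4 + a = v * Y ^ 4 := by rw [ha]; omega
    have hle' : ((w * Z ^ 4 : ℕ) : ℝ) ≤ ((v * Y ^ 4 : ℕ) : ℝ) := by exact_mod_cast hlt.le
    have habs : |((w * Z ^ 4 : ℕ) : ℝ) - ((v * Y ^ 4 : ℕ) : ℝ)| = (a : ℝ) := by
      rw [abs_sub_comm, abs_of_nonneg (sub_nonneg.mpr hle'), ha, Nat.cast_sub hlt.le]
    rw [habs] at hnot
    have hcopa : Nat.Coprime (w * Z ^ 4) a := by rw [ha, Nat.coprime_sub_self_right hlt.le]; exact hcop4.symm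
    have hKlt := hKabc _ _ _ (⟨Nat.mul_pos hw (pow_pos (by omega) 4), ha0, hsum, hcopa⟩ : IsABCTriple _ _ _)
    have hprodpos : 0 < a * (v * Y) * (w * Z) :=
      Nat.mul_pos (Nat.mul_pos ha0 (Nat.mul_pos hv hY)) (Nat.mul_pos hw (by omega))
    have hrad_dvd : rad (w * Z ^ 4) a (v * Y ^ 4) ∣ a * (v * Y) * (w * Z) := by
      have h := rad_binomial_dvd a v w Y Z
      rw [rad_def] at h ⊢
      rwa [show w * Z ^ 4 * a * (v * Y ^ 4) = a * (v * Y ^ 4) * (w * Z ^ 4) by ring]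
    have hRle : ((rad (w * Z ^ 4) a (v * Y ^ 4) : ℕ) : ℝ) ≤ (a:ℝ) * v * w * Y * Z := by
      have h' : ((rad (w * Z ^ 4) a (v * Y ^ 4) : ℕ) : ℝ) ≤ ((a * (v * Y) * (w * Z) : ℕ) : ℝ) := by
        exact_mod_cast Nat.le_of_dvd hprodpos hrad_dvd
      push_cast at h'; linarith [h', show (a:ℝ) * (v * Y) * (w * Z) = (a:ℝ) * v * w * Y * Z by ring]
    have hY4 : (v:ℝ) * (Y:ℝ) ^ (4:ℕ) ≤ 2 * (w:ℝ) * (Z:ℝ) ^ (4:ℕ) := by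
      have h1 : ((v * Y ^ 4 : ℕ) : ℝ) = ((w * Z ^ 4 : ℕ) : ℝ) + (a : ℝ) := by exact_mod_cast hsum.symm
      push_cast at h1; linarith [h1, hnot, hφ4]
    have hc : (w:ℝ) * (Z:ℝ) ^ (4:ℕ) ≤ ((v * Y ^ 4 : ℕ) : ℝ) := by push_cast at hle' ⊢; exact hle'
    have key := abc_enemy_numerics_sharp hK hs hδ hsdef hθv hφ hZR (by positivity) hvR hwR
      (by positivity) hRle hc hKlt hnot hvθ hwθ hY4
    exact absurd (lt_of_lt_of_le key (hN Z hZN)) (lt_irrefl _)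
  · -- case vY⁴ < wZ⁴ : triple (vY⁴) + a = wZ⁴, c = wZ⁴
    set a : ℕ := w * Z ^ 4 - v * Y ^ 4 with ha
    have ha0 : 0 < a := Nat.sub_pos_of_lt hgt
    have hsum : v * Y ^ 4 + a = w * Z ^ 4 := by rw [ha]; omega
    have hle' : ((v * Y ^ 4 : ℕ) : ℝ) ≤ ((w * Z ^ 4 : ℕ) : ℝ) := by exact_mod_cast hgt.le
    have habs : |((w * Z ^ 4 : ℕ) : ℝ) - ((v * Y ^ 4 : ℕ) : ℝ)| = (a : ℝ) := by
      rw [abs_of_nonneg (sub_nonneg.mpr hle'), ha, Nat.cast_sub hgt.le]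
    rw [habs] at hnot
    have hcopa : Nat.Coprime (v * Y ^ 4) a := by rw [ha, Nat.coprime_sub_self_right hgt.le]; exact hcop4
    have hKlt := hKabc _ _ _ (⟨Nat.mul_pos hv (pow_pos hY 4), ha0, hsum, hcopa⟩ : IsABCTriple _ _ _)
    have hprodpos : 0 < a * (v * Y) * (w * Z) :=
      Nat.mul_pos (Nat.mul_pos ha0 (Nat.mul_pos hv hY)) (Nat.mul_pos hw (by omega))
    have hrad_dvd : rad (v * Y ^ 4) a (w * Z ^ 4) ∣ a * (v * Y) * (w * Z) := rad_binomial_dvd' a v w Y Z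
    have hRle : ((rad (v * Y ^ 4) a (w * Z ^ 4) : ℕ) : ℝ) ≤ (a:ℝ) * v * w * Y * Z := by
      have h' : ((rad (v * Y ^ 4) a (w * Z ^ 4) : ℕ) : ℝ) ≤ ((a * (v * Y) * (w * Z) : ℕ) : ℝ) := by
        exact_mod_cast Nat.le_of_dvd hprodpos hrad_dvd
      push_cast at h'; linarith [h', show (a:ℝ) * (v * Y) * (w * Z) = (a:ℝ) * v * w * Y * Z by ring]
    have hY4 : (v:ℝ) * (Y:ℝ) ^ (4:ℕ) ≤ 2 * (w:ℝ) * (Z:ℝ) ^ (4:ℕ) := by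
      push_cast at hle'; linarith [hle', show (0:ℝ) ≤ (w:ℝ) * (Z:ℝ) ^ (4:ℕ) by positivity]
    have hc : (w:ℝ) * (Z:ℝ) ^ (4:ℕ) ≤ ((w * Z ^ 4 : ℕ) : ℝ) := by push_cast; exact le_rfl
    have key := abc_enemy_numerics_sharp hK hs hδ hsdef hθv hφ hZR (by positivity) hvR hwR
      (by positivity) hRle hc hKlt hnot hvθ hwθ hY4
    exact absurd (lt_of_lt_of_le key (hN Z hZN)) (lt_irrefl _)

/-- **`ABC ⟹ UBQ₂ θ φ` on the WHOLE random-model half-plane `θ + φ < 2`, `θ ≥ 0`** (sharpens `ubq₂_of_abc`, p137739,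
whose line was `(9/4)θ + φ < 2`).  For `φ < 0` the matrix is trivially true (a non-zero integer has absolute value
`≥ 1 > Z^φ` for `Z ≥ 2`); for `φ ≥ 0` it is `ubq₃_of_abc` at `θ_v = θ_w = θ`. -/
theorem ubq₂_of_abc_sharp (habc : ABC) {θ φ : ℝ} (hθ : 0 ≤ θ) (hline : θ + φ < 2) :
    ∃ Z₀ : ℕ, ∀ v w Y Z : ℕ, Z₀ ≤ Z → 0 < v → 0 < w → 0 < Y → Nat.Coprime (v * Y) (w * Z) →
      ((max v w : ℕ) : ℝ) ≤ (Z : ℝ) ^ θ → w * Z ^ 4 ≠ v * Y ^ 4 →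
      (Z : ℝ) ^ φ < |((w * Z ^ 4 : ℕ) : ℝ) - ((v * Y ^ 4 : ℕ) : ℝ)| := by
  rcases lt_or_ge φ 0 with hφ | hφ
  · -- trivial range φ < 0
    refine ⟨2, fun v w Y Z hZ _ _ _ _ _ hne => ?_⟩
    have hZR : (1:ℝ) < (Z:ℝ) := by exact_mod_cast (lt_of_lt_of_le (by norm_num) hZ)
    have h1 : (Z:ℝ) ^ φ < 1 := Real.rpow_lt_one_of_one_lt_of_neg hZR hφ
    have hint : (1:ℝ) ≤ |((w * Z ^ 4 : ℕ) : ℝ) - ((v * Y ^ 4 : ℕ) : ℝ)| := by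
      rcases lt_or_gt_of_ne hne with h | h
      · have h' : w * Z ^ 4 + 1 ≤ v * Y ^ 4 := h
        have : ((w * Z ^ 4 : ℕ) : ℝ) + 1 ≤ ((v * Y ^ 4 : ℕ) : ℝ) := by exact_mod_cast h'
        rw [abs_sub_comm, abs_of_nonneg (by linarith)]; linarith
      · have h' : v * Y ^ 4 + 1 ≤ w * Z ^ 4 := h
        have : ((v * Y ^ 4 : ℕ) : ℝ) + 1 ≤ ((w * Z ^ 4 : ℕ) : ℝ) := by exact_mod_cast h'
        rw [abs_of_nonneg (by linarith)]; linarith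
    linarith
  · obtain ⟨Z₀, h⟩ := ubq₃_of_abc habc hθ hθ hφ (by linarith)
    refine ⟨Z₀, fun v w Y Z hZ hv hw hY hcop hmax hne => h v w Y Z hZ hv hw hY hcop ?_ ?_ hne⟩
    · exact le_trans (by exact_mod_cast le_max_left v w) hmax
    · exact le_trans (by exact_mod_cast le_max_right v w) hmax


/-! ## Consequences on the diagonal, on the axis `φ = 0`, and for the moving-target ladder -/

/-- **Diagonal: `ABC ⟹ UBQ η` for every `0 ≤ η < 1`** — the random-model critical value (was `η < 8/13`,
`ubq_of_abc`).  With the unconditional ceiling `η ≤ 3/2` (`not_ubq_of_three_halves_lt`, p106450) the uniform dial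
of the crux-equivalent core lies in `[1, 3/2]` under `ABC`. -/
theorem ubq_of_abc_sharp (habc : ABC) {η : ℝ} (hη0 : 0 ≤ η) (hη : η < 1) :
    ∃ Z₀ : ℕ, ∀ v w Y Z : ℕ, Z₀ ≤ Z → 0 < v → 0 < w → 0 < Y → Nat.Coprime (v * Y) (w * Z) →
      ((max v w : ℕ) : ℝ) ≤ (Z : ℝ) ^ η → w * Z ^ 4 ≠ v * Y ^ 4 →
      (Z : ℝ) ^ η < |((w * Z ^ 4 : ℕ) : ℝ) - ((v * Y ^ 4 : ℕ) : ℝ)| :=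
  ubq₂_of_abc_sharp habc hη0 (by linarith)

/-- **The axis `φ = 0` is PINNED at `θ* = 2` under `ABC`**: bounded values (`|wZ⁴ − vY⁴| ≤ 1 = Z⁰`) need
coefficient height `> Z^θ` for every `θ < 2` (`ABC`), and occur at height `≤ 28Z²` (the Pell–Bezout torus family,
`not_ubq₂_corner_two_zero`, p138228, unconditional).  So the torus corner `(2, 0)` is OPTIMAL short of `¬ABC`:
no enemy family of bounded value exists below quadratic coefficient height unless `ABC` fails
(cycle 11 had `8/9 ≤ θ* ≤ 2`). -/
theorem ubq₂_axis_iff_of_abc (habc : ABC) {θ : ℝ} (hθ0 : 0 ≤ θ) (hθ2 : θ ≠ 2) :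
    (∃ Z₀ : ℕ, ∀ v w Y Z : ℕ, Z₀ ≤ Z → 0 < v → 0 < w → 0 < Y → Nat.Coprime (v * Y) (w * Z) →
      ((max v w : ℕ) : ℝ) ≤ (Z : ℝ) ^ θ → w * Z ^ 4 ≠ v * Y ^ 4 →
      (Z : ℝ) ^ (0:ℝ) < |((w * Z ^ 4 : ℕ) : ℝ) - ((v * Y ^ 4 : ℕ) : ℝ)|) ↔ θ < 2 := by
  constructor
  · intro h
    by_contra hge
    push Not at hge
    exact not_ubq₂_corner_two_zero θ 0 (lt_of_le_of_ne hge (Ne.symm hθ2)) le_rfl h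
  · intro hθ
    exact ubq₂_of_abc_sharp habc hθ0 (by linarith)

/-- **Unconditional sharpness of the half-plane**: no half-plane `θ + φ < c` with `c > 2` can be TRUE (the torus corner
`(2,0)` lies on the boundary line `θ + φ = 2`; so does the Dirichlet limit corner `(0,2)`).  Hence `ubq₂_of_abc_sharp` is
the best possible statement of its shape, and an `ABC`-world two-exponent diagram is TRUE strictly below the
random-model line and FALSE at the two proved points on it. -/
theorem ubq₂_halfPlane_le_two {c : ℝ}
    (h : ∀ θ φ : ℝ, 0 ≤ θ → 0 ≤ φ → θ + φ < c →
      ∃ Z₀ : ℕ, ∀ v w Y Z : ℕ, Z₀ ≤ Z → 0 < v → 0 < w → 0 < Y → Nat.Coprime (v * Y) (w * Z) →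
        ((max v w : ℕ) : ℝ) ≤ (Z : ℝ) ^ θ → w * Z ^ 4 ≠ v * Y ^ 4 →
        (Z : ℝ) ^ φ < |((w * Z ^ 4 : ℕ) : ℝ) - ((v * Y ^ 4 : ℕ) : ℝ)|) :
    c ≤ 2 := by
  by_contra hc
  push Not at hc
  exact not_ubq₂_corner_two_zero ((c + 2) / 2) 0 (by linarith) le_rfl
    (h ((c + 2) / 2) 0 (by linarith) le_rfl (by linarith))

/-- The same for the three-exponent half-space: `(3/4)θ_v + (1/4)θ_w + φ < c` TRUE forces `c ≤ 2` (Pell–Bezout has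
`θ_v = θ_w = 2`, `φ = 0`, ON the torus Mason–Stothers plane). -/
theorem ubq₃_halfSpace_le_two {c : ℝ}
    (h : ∀ θv θw φ : ℝ, 0 ≤ θv → 0 ≤ θw → 0 ≤ φ → 3 / 4 * θv + θw / 4 + φ < c →
      ∃ Z₀ : ℕ, ∀ v w Y Z : ℕ, Z₀ ≤ Z → 0 < v → 0 < w → 0 < Y → Nat.Coprime (v * Y) (w * Z) →
        (v : ℝ) ≤ (Z : ℝ) ^ θv → (w : ℝ) ≤ (Z : ℝ) ^ θw → w * Z ^ 4 ≠ v * Y ^ 4 →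
        (Z : ℝ) ^ φ < |((w * Z ^ 4 : ℕ) : ℝ) - ((v * Y ^ 4 : ℕ) : ℝ)|) :
    c ≤ 2 := by
  by_contra hc
  push Not at hc
  obtain ⟨Z₀, hZ₀⟩ := h ((c + 2) / 2) ((c + 2) / 2) 0 (by linarith) (by linarith) le_rfl (by linarith)
  refine not_ubq₂_corner_two_zero ((c + 2) / 2) 0 (by linarith) le_rfl ⟨Z₀, ?_⟩
  intro v w Y Z hZ hv hw hY hcop hmax hne
  exact hZ₀ v w Y Z hZ hv hw hY hcop (le_trans (by exact_mod_cast le_max_left v w) hmax)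
    (le_trans (by exact_mod_cast le_max_right v w) hmax) hne

/-- **Roth rung of the strategist's ladder at the RANDOM-MODEL budget**: `ABC ⟹` the saving `Z^{2−ε}` at every
coefficient budget `0 ≤ η < ε` (`StrategistSketch.UniformMovingRoth4` asks `∀ ε ∈ (0,1) ∃ η > 0`; its `ABC`-proof
`uniformMovingRoth4_of_abc`, p137739, had `η = ε/5`, any `η < 4ε/9`).  Unconditionally `η ≤ 1` for `ε < 1/2` (p137739). -/
theorem movingRoth4_of_abc_of_lt (habc : ABC) {ε η : ℝ} (hη0 : 0 ≤ η) (hηε : η < ε) :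
    ∃ Z₀ : ℕ, ∀ v w Y Z : ℕ, Z₀ ≤ Z → 0 < v → 0 < w → 0 < Y →
      Nat.Coprime (v * Y) (w * Z) → ((max v w : ℕ) : ℝ) ≤ (Z : ℝ) ^ η → w * Z ^ 4 ≠ v * Y ^ 4 →
      (Z : ℝ) ^ (2 - ε) < |((w * Z ^ 4 : ℕ) : ℝ) - ((v * Y ^ 4 : ℕ) : ℝ)| :=
  ubq₂_of_abc_sharp habc hη0 (by linarith)

/-- **Thue rung at the RANDOM-MODEL budget**: `ABC ⟹` the saving `Z^{1−ε}` at every budget `0 ≤ η < 1 + ε` — in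
particular at the `ε`-INDEPENDENT budget `η = 1` (`StrategistSketch.UniformMovingThue4`; `uniformMovingThue4_of_abc`,
p137739, had `(1+ε)/3`, any `η < 4(1+ε)/9`).  With the unconditional ceiling `η ≤ 2` (`movingThue4_budget_le_two`,
p138228) the Thue-rung budget is bracketed `[1 + ε, 2]` under `ABC`. -/
theorem movingThue4_of_abc_of_lt (habc : ABC) {ε η : ℝ} (hη0 : 0 ≤ η) (hηε : η < 1 + ε) :
    ∃ Z₀ : ℕ, ∀ v w Y Z : ℕ, Z₀ ≤ Z → 0 < v → 0 < w → 0 < Y →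
      Nat.Coprime (v * Y) (w * Z) → ((max v w : ℕ) : ℝ) ≤ (Z : ℝ) ^ η → w * Z ^ 4 ≠ v * Y ^ 4 →
      (Z : ℝ) ^ (1 - ε) < |((w * Z ^ 4 : ℕ) : ℝ) - ((v * Y ^ 4 : ℕ) : ℝ)| :=
  ubq₂_of_abc_sharp habc hη0 (by linarith)

/-- The Thue rung at `η = 1`, for every `ε > 0`. -/
theorem movingThue4_of_abc_one (habc : ABC) {ε : ℝ} (hε : 0 < ε) :
    ∃ Z₀ : ℕ, ∀ v w Y Z : ℕ, Z₀ ≤ Z → 0 < v → 0 < w → 0 < Y →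
      Nat.Coprime (v * Y) (w * Z) → ((max v w : ℕ) : ℝ) ≤ (Z : ℝ) ^ (1:ℝ) → w * Z ^ 4 ≠ v * Y ^ 4 →
      (Z : ℝ) ^ (1 - ε) < |((w * Z ^ 4 : ℕ) : ℝ) - ((v * Y ^ 4 : ℕ) : ℝ)| :=
  movingThue4_of_abc_of_lt habc zero_le_one (by linarith)

/-- **Bounded `v`: fourth powers plus something small have no large biquadrate cofactor, under `ABC`.**  The column
`θ_v = 0` of `ubq₃_of_abc`: for `v = 1` (`Y⁴ ± a = wZ⁴`), a value `a ≤ Z^φ` forces `w > Z^{θ_w}` whenever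
`θ_w/4 + φ < 2` — e.g. value `1` needs `w > Z^{8−o(1)}`, i.e. `Z⁴ ∣ Y⁴ ± 1 ⟹ Z ≤ Y^{1/3+o(1)}`.  (Instance, for the
ideators' anchored / unit slices.) -/
theorem ubq₃_of_abc_unit_v (habc : ABC) {θw φ : ℝ} (hθw : 0 ≤ θw) (hφ : 0 ≤ φ) (h : θw / 4 + φ < 2) :
    ∃ Z₀ : ℕ, ∀ w Y Z : ℕ, Z₀ ≤ Z → 0 < w → 0 < Y → Nat.Coprime Y (w * Z) →
      (w : ℝ) ≤ (Z : ℝ) ^ θw → w * Z ^ 4 ≠ Y ^ 4 →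
      (Z : ℝ) ^ φ < |((w * Z ^ 4 : ℕ) : ℝ) - ((Y ^ 4 : ℕ) : ℝ)| := by
  obtain ⟨Z₀, hZ₀⟩ := ubq₃_of_abc habc le_rfl hθw hφ (by linarith : 3 / 4 * (0:ℝ) + θw / 4 + φ < 2)
  refine ⟨max Z₀ 1, fun w Y Z hZ hw hY hcop hwθ hne => ?_⟩
  have h1 : ((1:ℕ):ℝ) ≤ (Z:ℝ) ^ (0:ℝ) := by rw [Real.rpow_zero]; norm_num
  have := hZ₀ 1 w Y Z (le_trans (le_max_left _ _) hZ) one_pos hw hY (by simpa using hcop) h1 hwθ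
    (by simpa using hne)
  simpa using this

end Summit.ABC.ABC.Theorems.TowerFourSubLiouville.Negative
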